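import Literature.Computability.Complexity.CoinTruncation
import Literature.Computability.Complexity.PairPlumbing
import Literature.Computability.Complexity.StringEquality
import Literature.Computability.Complexity.PRelHierarchy
import Literature.Computability.Complexity.Counting
import Literature.Computability.Complexity.PolyAdviceClosure
import HarnessLib

/-!
# `#P` is closed under polynomial-time preprocessing; advice classes are idempotent

Trunk T-CPLX-CORE. Bookkeeping facts for counting and advice classes, used by the proof of
Bürgisser's Theorem 3.1 (`NP/poly ⊆ Mod_pNP/poly`, TCS 235 (2000), p. 77): the "polynomial advice"
of a `Mod_pNP` computation has to be re-paired, and the counting function has to read a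
pre-processed input.

* `exists_padRel`, `countWitnesses_of_padSpec` — **padding witnesses**: intersecting a relation
  with the test "the witness beyond position `r(|u|)` is all ones" (in `P` by the coin-truncation
  maps of `CoinTruncation.lean`, the pairing combinators of `PRelHierarchy.lean` and the equality
  test of `StringEquality.lean`) does not change the number of witnesses, whatever the nominal
  witness length `m' ≥ r(|u|)` (Arora–Barak 2009, Def. 17.2, remark "the `≤ p|x|` variant gives
  the same class: pad witnesses").
* `comp_mem_SharpP` — **`φ ∈ #P`, `f ∈ FP ⇒ φ ∘ f ∈ #P`** (Valiant 1979, §2; the relation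
  `mapFst(f)⁻¹(padRel r R)` with witness length `r(s(|z|))`).
* `preimage_mem_modCount` — hence the class `{L | ∃ φ ∈ #P, x ∈ L ↔ φ(x) ≡ 1 mod p}` (Bürgisser's
  `Mod_pNP`, TCS 235 p. 75) is closed under Karp reductions.
* `subset_polyAdvice_of_preimage_closed`, `polyAdvice_polyAdvice_subset` — **`K ⊆ K/poly` and
  `(K/poly)/poly ⊆ K/poly`** for every class `K` closed under polynomial-time preimages (concatenate
  the two advice strings; Karp–Lipton 1982, §1; Arora–Barak 2009, Def. 6.16).

No definitions: the padded relation is provided by an existence statement (`exists_padRel`).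

## References

* L. G. Valiant, *The complexity of computing the permanent*, Theoret. Comput. Sci. 8 (1979), §2.
* S. Arora, B. Barak, *Computational Complexity: A Modern Approach*, CUP 2009, Def. 6.16, Def. 17.2.
* R. M. Karp, R. J. Lipton, *Turing machines that take advice*, Enseign. Math. 28 (1982), §1.
* P. Bürgisser, *Cook's versus Valiant's hypothesis*, Theoret. Comput. Sci. 235 (2000), p. 75, 77.
-/

noncomputable section

namespace Literature.Computability.Complexity

open scoped Classical
open _root_.Computability Polynomial

/-! ### All-ones strings -/

/-- `onesFn u = 1^{|u|}` (`unaryEncodeNat n = 1ⁿ`). [folklore] -/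
theorem onesFn_eq_replicate (u : List Bool) : onesFn u = List.replicate u.length true := by
  have h : ∀ n : ℕ, unaryEncodeNat n = List.replicate n true := by
    intro n
    induction n with
    | zero => rfl
    | succ n ih => simp [unaryEncodeNat, ih, List.replicate_succ]
  rw [onesFn, h]

/-! ### Padded witness relations -/

/-- **A padded relation in `P`**: for `R ∈ P` and `r` there is `Rp ∈ P` with
`⟨u, y'⟩ ∈ Rp ↔ ⟨u, y'↾r(|u|)⟩ ∈ R ∧ (y' beyond position r(|u|) is all ones)` — namely
`(truncSndFn r)⁻¹(R) ⊓ {w | sndP (dropSndFn r w) = onesFn (sndP (dropSndFn r w))}` (coin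
truncation of `CoinTruncation.lean`, projections of `PRelHierarchy.lean`, the equality test of
`StringEquality.lean`). [cite: AroraBarak2009, Def. 17.2] -/
theorem exists_padRel (r : Polynomial ℕ) {R : Language Bool} (hR : R ∈ Classes.P) :
    ∃ Rp : Language Bool, Rp ∈ Classes.P ∧ ∀ u y' : List Bool, boolPair u y' ∈ Rp ↔
      boolPair u (y'.take (r.eval u.length)) ∈ R ∧
        y'.drop (r.eval u.length) = List.replicate (y'.length - r.eval u.length) true := by
  have hf : (sndP ∘ dropSndFn r) ∈ FP := comp_mem_FP sndP_mem_FP (dropSndFn_mem_FP r)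
  have hg : (onesFn ∘ (sndP ∘ dropSndFn r)) ∈ FP := comp_mem_FP onesFn_mem_FP hf
  refine ⟨(truncSndFn r ⁻¹' R : Language Bool) ⊓
      ({w | (sndP ∘ dropSndFn r) w = (onesFn ∘ (sndP ∘ dropSndFn r)) w} : Language Bool),
    inter_mem_P (preimage_mem_P hR (truncSndFn_mem_FP r)) (setOf_apply_eq_apply_mem_P hf hg),
    fun u y' => ?_⟩
  change truncSndFn r (boolPair u y') ∈ R ∧
    (sndP ∘ dropSndFn r) (boolPair u y') = (onesFn ∘ (sndP ∘ dropSndFn r)) (boolPair u y') ↔ _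
  simp only [Function.comp_apply]
  rw [truncSndFn_boolPair, dropSndFn_boolPair, sndP_boolPair, onesFn_eq_replicate,
    List.length_drop]

/-- **Padding does not change the count**: if `⟨u, y'⟩ ∈ Rp ↔ ⟨u, y'↾m⟩ ∈ R ∧ y' = (y'↾m) 1^*`,
then for `m' ≥ m` the number of `y' ∈ {0,1}^{m'}` with `⟨u, y'⟩ ∈ Rp` equals the number of
`y ∈ {0,1}^m` with `⟨u, y⟩ ∈ R` (the bijection `y ↦ y 1^{m' - m}`; Arora–Barak 2009, Def. 17.2,
remark on padding witnesses). [cite: AroraBarak2009, Def. 17.2] -/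
theorem countWitnesses_of_padSpec (R Rp : Language Bool) (u : List Bool) (m : ℕ)
    (hspec : ∀ y' : List Bool, boolPair u y' ∈ Rp ↔
      boolPair u (y'.take m) ∈ R ∧ y'.drop m = List.replicate (y'.length - m) true)
    {m' : ℕ} (hm : m ≤ m') : countWitnesses Rp m' u = countWitnesses R m u := by
  unfold countWitnesses
  refine Finset.card_nbij' (fun y' => ⟨y'.toList.take m, by simp [hm]⟩)
    (fun y => ⟨y.toList ++ List.replicate (m' - m) true, by simp; omega⟩)
    (fun y' hy' => ?_) (fun y hy => ?_) (fun y' hy' => ?_) (fun y _ => ?_)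
  · simp only [Finset.coe_filter, Finset.mem_univ, true_and, Set.mem_setOf_eq,
      List.Vector.toList_mk] at hy' ⊢
    exact ((hspec _).1 hy').1
  · simp only [Finset.coe_filter, Finset.mem_univ, true_and, Set.mem_setOf_eq,
      List.Vector.toList_mk] at hy ⊢
    rw [hspec]
    have hlen : y.toList.length = m := by simp
    constructor
    · rw [List.take_left' hlen]
      exact hy
    · rw [List.drop_left' hlen, List.length_append, hlen, List.length_replicate]
      simp
  · simp only [Finset.coe_filter, Finset.mem_univ, true_and, Set.mem_setOf_eq] at hy'
    obtain ⟨-, hdrop⟩ := (hspec _).1 hy'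
    apply Subtype.ext
    have hlen : y'.toList.length = m' := by simp
    change y'.toList.take m ++ List.replicate (m' - m) true = y'.toList
    conv_rhs => rw [← List.take_append_drop m y'.toList]
    rw [hdrop, hlen]
  · apply Subtype.ext
    have hlen : y.toList.length = m := by simp
    change (y.toList ++ List.replicate (m' - m) true).take m = y.toList
    rw [List.take_left' hlen]

/-- Counting witnesses through a map on the first component:
`#_y [⟨z, y⟩ ∈ mapFst(f)⁻¹ X] = #_y [⟨f z, y⟩ ∈ X]`. [folklore] -/
theorem countWitnesses_preimage_mapFstFn (f : List Bool → List Bool) (X : Language Bool) (m : ℕ)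
    (z : List Bool) :
    countWitnesses (mapFstFn f ⁻¹' X : Language Bool) m z = countWitnesses X m (f z) := by
  unfold countWitnesses
  congr 1
  refine Finset.filter_congr fun y _ => ?_
  change mapFstFn f (boolPair z y.toList) ∈ X ↔ _
  rw [mapFstFn_boolPair]

/-! ### `#P` is closed under polynomial-time preprocessing -/

/-- **`φ ∈ #P` and `f ∈ FP` imply `φ ∘ f ∈ #P`** (Valiant 1979, §2; Arora–Barak 2009, Def. 17.2):
with `φ(v) = #_{|y| = r(|v|)} [⟨v, y⟩ ∈ R]`, the relation `mapFst(f)⁻¹(padRel r R)` and the witness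
length `r(s(|z|))`, `s` an output-length bound of `f`, count `φ(f z)`. [cite: Valiant1979, §2] [cite: AroraBarak2009, Def. 17.2] -/
theorem comp_mem_SharpP {φ : List Bool → ℕ} (hφ : φ ∈ SharpP) {f : List Bool → List Bool}
    (hf : f ∈ FP) : (φ ∘ f) ∈ SharpP := by
  obtain ⟨R, hR, r, hr⟩ := hφ
  obtain ⟨s, hs⟩ := exists_poly_length_le_of_mem_FP hf
  obtain ⟨Rp, hRp, hspec⟩ := exists_padRel r hR
  refine ⟨mapFstFn f ⁻¹' Rp, preimage_mem_P hRp (mapFstFn_mem_FP hf), r.comp s, fun z => ?_⟩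
  rw [countWitnesses_preimage_mapFstFn, Function.comp_apply, hr,
    countWitnesses_of_padSpec R Rp (f z) (r.eval (f z).length) (hspec (f z))]
  rw [eval_comp]
  exact TM2Iter.eval_mono r (hs z)

/-- **Closure of the `mod p` counting classes under Karp reductions**: if `x ∈ L ↔ φ(x) ≡ 1 mod p`
with `φ ∈ #P` (Bürgisser's `Mod_pNP`, TCS 235 p. 75), then `f⁻¹(L)` is of the same form for
`f ∈ FP` (with `φ ∘ f`). [cite: Burgisser2000TCS, §2 p. 75] -/
theorem preimage_mem_modCount (p : ℕ) {L : Language Bool}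
    (hL : L ∈ {L : Language Bool | ∃ φ ∈ SharpP, ∀ x : List Bool, x ∈ L ↔ φ x % p = 1})
    {f : List Bool → List Bool} (hf : f ∈ FP) :
    (f ⁻¹' L : Language Bool) ∈
      {L : Language Bool | ∃ φ ∈ SharpP, ∀ x : List Bool, x ∈ L ↔ φ x % p = 1} := by
  obtain ⟨φ, hφ, hφL⟩ := hL
  exact ⟨φ ∘ f, comp_mem_SharpP hφ hf, fun x => hφL (f x)⟩

/-! ### Advice: `K ⊆ K/poly` and `(K/poly)/poly ⊆ K/poly` -/

/-- **`K ⊆ K/poly`** (empty advice) for a class closed under polynomial-time preimages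
(Arora–Barak 2009, Def. 6.16 remark). [cite: AroraBarak2009, Def. 6.16] -/
theorem subset_polyAdvice_of_preimage_closed {K : Set (Language Bool)}
    (hK : ∀ L ∈ K, ∀ f : List Bool → List Bool, f ∈ FP → (f ⁻¹' L : Language Bool) ∈ K) :
    K ⊆ polyAdvice K :=
  subset_polyAdvice_of_closed_fst K fun L hL => hK L hL _ boolUnpairFst_mem_FP

/-- **`(K/poly)/poly ⊆ K/poly`** for a class closed under polynomial-time preimages: the advice
`⟨a(n), b(2n + 2 + |a(n)|)⟩` and the re-association `⟨x, ⟨a, b⟩⟩ ↦ ⟨⟨x, a⟩, b⟩` (an `FP` map,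
`pairFn`/`fstP`/`sndP`) (Karp–Lipton 1982, §1; Arora–Barak 2009, Def. 6.16).
[cite: KarpLipton1980, §1] [cite: AroraBarak2009, Def. 6.16] -/
theorem polyAdvice_polyAdvice_subset {K : Set (Language Bool)}
    (hK : ∀ L ∈ K, ∀ f : List Bool → List Bool, f ∈ FP → (f ⁻¹' L : Language Bool) ∈ K) :
    polyAdvice (polyAdvice K) ⊆ polyAdvice K := by
  rintro L ⟨L₁, ⟨L₂, hL₂, b, pb, hb, hL₁⟩, a, pa, ha, hL⟩
  -- the re-association `⟨x, ⟨a, b⟩⟩ ↦ ⟨⟨x, a⟩, b⟩`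
  let assoc : List Bool → List Bool := pairFn (pairFn fstP (fstP ∘ sndP)) (sndP ∘ sndP)
  have hassocFP : assoc ∈ FP :=
    pairFn_mem_FP (pairFn_mem_FP fstP_mem_FP (comp_mem_FP fstP_mem_FP sndP_mem_FP))
      (comp_mem_FP sndP_mem_FP sndP_mem_FP)
  have hassoc : ∀ x u v : List Bool,
      assoc (boolPair x (boolPair u v)) = boolPair (boolPair x u) v := fun x u v => by
    simp [assoc]
  refine ⟨assoc ⁻¹' L₂, hK _ hL₂ _ hassocFP,
    fun n => boolPair (a n) (b (2 * n + 2 + (a n).length)), 2 * pa + 2 + pb.comp (2 * X + 2 + pa),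
    fun n => ?_, fun x => ?_⟩
  · rw [length_boolPair]
    have h1 := ha n
    have h2 := hb (2 * n + 2 + (a n).length)
    have h3 : pb.eval (2 * n + 2 + (a n).length) ≤ pb.eval (2 * n + 2 + pa.eval n) :=
      TM2Iter.eval_mono pb (by omega)
    simp only [eval_add, eval_mul, eval_ofNat, eval_X, eval_comp]
    omega
  · rw [hL x, hL₁ (boolPair x (a x.length)), length_boolPair]
    change _ ↔ assoc (boolPair x (boolPair (a x.length) (b (2 * x.length + 2 + (a x.length).length))))
      ∈ L₂
    rw [hassoc]

end Literature.Computability.Complexity
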